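import Literature.NumberTheory.Automorphic.Liu2021.Prop46NonemptyOfCasselman
import Literature.NumberTheory.Automorphic.HeckeCharacterLocalComponentSmooth
import Literature.NumberTheory.Automorphic.AdicCompletionCompact
import HarnessLib

/-!
# [Liu 2021] Proposition 4.6 (1) from Casselman's theorem — the local-unit clause of (19.10b) discharged

Sequel of `Liu2021/Prop46NonemptyOfCasselman` (theorems only; no definition, no named fact).  There the inhabitant of
`Def45.CMDatum` — [Liu2021] Prop. 4.6 (1) «`𝒜(μ)` is nonempty» (`FJcycle.tex` l. 1969) — was derived from Casselman's
theorem ([Shimura1998] Thm. 21.4, tree fact `shimura1998_thm21_4_casselman`) modulo TWO displayed hypotheses on `μ`, the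
two halves of the ideal clause «`χ(x)𝔞 = f(x)𝔞`» of [Shimura1998] (19.10b) for `χ = μ^{alg}`: `hu` (at local units:
`μ^{alg}(𝔬_v^×) ⊆ 𝔬_{M_μ}^×`) and `hπ` (at uniformisers).  THIS FILE proves `hu`:

* `exists_pow_localComponent_unitsMap_eq_one` — for ANY Hecke character `χ` of a number field and any local unit
  `u ∈ 𝔬_v^×`, `χ_v(u)^N = 1` for some `N ≥ 1`: `χ_v` is continuous with open kernel (tree `isOpen_ker_localComponent`,
  [BushnellHenniart2006] §1.5 / [TateThesis1967] §2.3: a quasi-character is trivial on an open subgroup of the compact group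
  `𝔬_v^×`), `𝔬_v^×` is compact (tree `compactSpace_adicCompletionIntegers'`), so the kernel has finite index `N` and `u^N`
  lies in it.
* `exists_unit_muAlg_localComponent` — hence `μ^{alg}(⟨u⟩_v)`, which lies in `M_μ` (by definition of `M_μ`, [Liu2021]
  l. 1928), is a root of unity of `M_μ`: an algebraic integer and a unit, `∈ 𝔬_{M_μ}^×` — the clause `hu`.
* **`nonempty_cmDatum_of_casselman_of_uniformizers`** — [Liu2021] Prop. 4.6 (1), first clause, from Casselman's theorem with
  ONLY the uniformiser clause `hπ` of (19.10b) («`(μ^{alg}(ϖ_v)) = g(N_{F/K*} 𝔭_v)`», the Shimura–Taniyama factorisation of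
  the values of `μ^{alg}`, in the tree's `IsReflexTypeNorm` form) and the posited `(λ_μ, r_μ)`-carrier left as hypotheses.

HONEST SCOPE as in the prequel: conditional on the cited `h21`, on `hπ`, and on an inhabitant of the ⟨CARRIER⟩ `P`;
HC_CM is not concerned.

## References
* [Liu2021] Y. Liu, Camb. J. Math. 9 (2021) = arXiv:2102.11518 — §4.1 l. 1928, Def. 4.5, Prop. 4.6 (1) (l. 1969, proof
  ll. 1975–1984).
* [Shimura1998] G. Shimura, *Abelian Varieties with Complex Multiplication and Modular Functions* (1998), Prop. 19.10
  (19.10b), §21.4 Thm. 21.4.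
* [TateThesis1967] J. Tate, *Fourier analysis in number fields and Hecke's zeta-functions*, in Cassels–Fröhlich (1967),
  §2.3 (quasi-characters; the units form a compact group).
* [BushnellHenniart2006] C. J. Bushnell, G. Henniart, *The local Langlands conjecture for GL(2)* (2006), §1.5.
-/

set_option autoImplicit false

noncomputable section

open scoped NumberField
open NumberField IsDedekindDomain
open Literature.AlgebraicGeometry.Motives
open Literature.NumberTheory.ComplexMultiplication
open Literature.NumberTheory.GaloisRepresentations

namespace Literature.NumberTheory.Automorphic.Liu2021.Def45

/-! ## §1 Values of a Hecke character on local units are roots of unity -/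

section RootsOfUnity

variable {K : Type} [Field K] [NumberField K]

/-- **`χ_v(u)^N = 1` for a local unit `u ∈ 𝔬_v^×`** (some `N ≥ 1`): the local component `χ_v` of a Hecke character has open
kernel (no small subgroups in `ℂˣ`), `𝔬_v^×` is compact, so the kernel of `χ_v|𝔬_v^×` has finite index `N`, and `u^N` lies
in it. [cite: TateThesis1967, §2.3] [cite: BushnellHenniart2006, §1.5] -/
theorem exists_pow_localComponent_unitsMap_eq_one (χ : HeckeCharacter K) (v : HeightOneSpectrum (𝓞 K))
    (u : (v.adicCompletionIntegers K)ˣ) :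
    ∃ N : ℕ, N ≠ 0 ∧
      (χ.localComponent v (Units.map ((v.adicCompletionIntegers K).subtype : _ →* _) u)) ^ N = 1 := by
  haveI : CompactSpace (v.adicCompletionIntegers K) := Automorphic.compactSpace_adicCompletionIntegers' K v
  set f : (v.adicCompletionIntegers K)ˣ →* (v.adicCompletion K)ˣ :=
    Units.map ((v.adicCompletionIntegers K).subtype : _ →* _) with hf_def
  have hf : Continuous f := Continuous.units_map _ continuous_subtype_val
  set H : Subgroup (v.adicCompletionIntegers K)ˣ := ((χ.localComponent v).ker).comap f with hH_def
  have hH : IsOpen (H : Set (v.adicCompletionIntegers K)ˣ) := (χ.isOpen_ker_localComponent v).preimage hf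
  haveI : Finite ((v.adicCompletionIntegers K)ˣ ⧸ H) := Subgroup.quotient_finite_of_isOpen H hH
  refine ⟨H.index, Subgroup.index_ne_zero_of_finite, ?_⟩
  have hmem : u ^ H.index ∈ H := Subgroup.pow_index_mem H u
  rw [hH_def, Subgroup.mem_comap, MonoidHom.mem_ker, map_pow, map_pow] at hmem
  exact hmem

end RootsOfUnity

/-! ## §2 The local-unit clause of (19.10b) for `χ = μ^{alg}` -/

section Units

variable {F : Type} [Field F] [NumberField F] {μ : IdeleClassGroup F →ₜ* Circle}

/-- **«`χ(x)𝔞 = f(x)𝔞` at local units» for `χ = μ^{alg}`, `𝔞 = 𝔬_{M_μ}`**: `μ^{alg}(⟨u⟩_v) ∈ 𝔬_{M_μ}^×` for every local unit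
`u ∈ 𝔬_v^×` — the value lies in `M_μ` ([Liu2021] l. 1928) and is a root of unity
(`exists_pow_localComponent_unitsMap_eq_one`), hence an algebraic integer and a unit.
[cite: Shimura1998, Prop. 19.10 (19.10b)] [cite: Liu2021, §4.1 (TeX l. 1928)] -/
theorem exists_unit_muAlg_localComponent (v : HeightOneSpectrum (𝓞 F)) (u : (v.adicCompletionIntegers F)ˣ) :
    ∃ b : (𝓞 (IdeleClassGroup.muAlgValueField F μ))ˣ,
      (((IdeleClassGroup.muAlg F μ).localComponent v
          (Units.map ((v.adicCompletionIntegers F).subtype : _ →* _) u) : ℂˣ) : ℂ) =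
        (IdeleClassGroup.muAlgValueField F μ).subtype
          ((b : 𝓞 (IdeleClassGroup.muAlgValueField F μ)) : IdeleClassGroup.muAlgValueField F μ) := by
  obtain ⟨N, hN, hpow⟩ := exists_pow_localComponent_unitsMap_eq_one (IdeleClassGroup.muAlg F μ) v u
  set z : ℂˣ := (IdeleClassGroup.muAlg F μ).localComponent v
    (Units.map ((v.adicCompletionIntegers F).subtype : _ →* _) u) with hz
  have hzmem : (z : ℂ) ∈ IdeleClassGroup.muAlgValueField F μ := by
    rw [hz, HeckeCharacter.localComponent_apply]
    exact IdeleClassGroup.coe_muAlg_mem_muAlgValueField F μ (localUnits_fst v _)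
  have hzN : (z : ℂ) ^ N = 1 := by
    rw [← Units.val_pow_eq_pow_val, hpow, Units.val_one]
  set b₀ : IdeleClassGroup.muAlgValueField F μ := ⟨z, hzmem⟩ with hb₀
  have hb₀N : b₀ ^ N = 1 := Subtype.ext (by rw [SubmonoidClass.coe_pow]; exact hzN)
  have hint : IsIntegral ℤ b₀ :=
    IsIntegral.of_pow (Nat.pos_of_ne_zero hN) (by rw [hb₀N]; exact isIntegral_one)
  set b₁ : 𝓞 (IdeleClassGroup.muAlgValueField F μ) := ⟨b₀, (mem_integralClosure_iff ℤ _).2 hint⟩ with hb₁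
  have hb₁N : b₁ ^ N = 1 := by
    apply RingOfIntegers.ext
    rw [RingOfIntegers.coe_eq_algebraMap, RingOfIntegers.coe_eq_algebraMap, map_pow, map_one]
    exact hb₀N
  refine ⟨Units.ofPowEqOne b₁ N hb₁N hN, ?_⟩
  rfl

end Units

/-! ## §3 Prop. 4.6 (1) from Casselman's theorem, with only the uniformiser clause displayed -/

section Main

variable {F : Type} [Field F] [NumberField F] [IsCMField F] [IsGalois ℚ F] (σ : F →+* ℂ)
  {μ : IdeleClassGroup F →ₜ* Circle} (hμ : IdeleClassGroup.IsConjugateSymplectic F μ)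
  (hw : IdeleClassGroup.HasWeight F μ 1)

/-- **[Liu2021, Prop. 4.6 (1)], first clause «`𝒜(μ)` is nonempty», from Casselman's theorem** — as
`nonempty_cmDatum_of_casselman`, with the local-unit clause of (19.10b) now PROVED (`exists_unit_muAlg_localComponent`):
GIVEN the cited `h21` ([Shimura1998] Thm. 21.4), the uniformiser clause `hπ` of (19.10b) for `μ^{alg}` («`χ(ϖ_v) = π_v`,
`(π_v) = g(N_{F/K*} 𝔭_v)`») and an inhabitant of the posited `(λ_μ, r_μ)`-carrier `P`, there is a CM datum for `μ` in the
as-printed sense `Def45.CMDatum (AlgHom.id ℚ F) σ hμ hw (Carriers.ofPolDR μ P)`. [cite: Liu2021, Prop. 4.6 (1) (TeX l. 1969) and its proof (ll. 1975–1984)]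
[cite: Shimura1998, §21.4 Thm. 21.4 and Prop. 19.10 (19.10b)] -/
theorem nonempty_cmDatum_of_casselman_of_uniformizers (h21 : shimura1998_thm21_4_casselman)
    (hπ : haveI := hμ.numberField_muAlgValueField
      ∀ v : HeightOneSpectrum (𝓞 F), ∃ π : 𝓞 (IdeleClassGroup.muAlgValueField F μ),
        (IdeleClassGroup.muAlg F μ).valueAtUniformizer v =
            (IdeleClassGroup.muAlgValueField F μ).subtype (π : IdeleClassGroup.muAlgValueField F μ) ∧
          ∀ (L : Type) [Field L] [NumberField L] [Normal ℚ L] (ιL : L →+* ℂ)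
            (j : IdeleClassGroup.muAlgValueField F μ →+* L) (σL : F →+* L), ιL.comp σL = σ →
            IsReflexTypeNorm
              (valuedIn ιL (inducedCMType (incl (AlgHom.id ℚ F) σ hμ) (reflexCMType σ hμ.cmType (AlgHom.id ℚ F))).1)
              j σL v.asIdeal (Ideal.span {π}))
    (P : ∀ A : AbelianVariety F, (IdeleClassGroup.muAlgValueField F μ →+* A.endAlgebra) → Type)
    (hP : ∀ A i, Nonempty (P A i)) :
    Nonempty (CMDatum (AlgHom.id ℚ F) σ hμ hw (Carriers.ofPolDR μ P)) :=
  nonempty_cmDatum_of_casselman σ hμ hw h21 (fun v u => exists_unit_muAlg_localComponent v u) hπ P hP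

end Main

end Literature.NumberTheory.Automorphic.Liu2021.Def45

end
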